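import Mathlib
import HarnessLib
import Summits.HubbardSuperconductivity.HubbardSuperconductivity.Theorems.KLProgrammeKLRegimeTwoVolumeTowerBaseGridSplice
import Summits.HubbardSuperconductivity.HubbardSuperconductivity.Theorems.KLProgrammeKLRegimeTwoVolumeTowerBaseGridSymbol
import Summits.HubbardSuperconductivity.HubbardSuperconductivity.Theorems.KLProgrammeKLRegimeTwoVolumeTowerBaseGridFrameSwap
import Summits.HubbardSuperconductivity.HubbardSuperconductivity.Theorems.KLProgrammeKLRegimeTwoVolumeScaleZeroTopFrameMom

/-!
# Route `KLProgramme` — crux K3, VL child `KLRegimeVolumeLimitV17F2` (stmt-HubbardSuperconductivity-20440), atom HB1 (grid half), cure of «GRID-CT-BUDGET»: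
# THE GRID-LEVEL TWO-VOLUME BASE DEFECT IN THE CANONICAL KEYED FORM, AT ONE INSTANCE, WITH THE COUNTERTERM GLUE BUDGET AT THE POSITION FIRST MOMENT
# (cell gate-hubbard-kl, seat p3 g18; twin of k3c4-p1 g13's `…TowerBaseGridDeg`; `--supports` 20440)

Verbatim twin of `…TowerBaseGridDeg.tower_base_grid_keyedDefect_le_deg` (k3c4-p1) built on M4a‴
(`…TwoVolumeScaleZeroTopFrameMom.hubbardGrid_sum_norm_kernel_twoVolume_stepZero_le_mom`) instead of M4a′: the counterterm glue budget reads
`hND : (|β|/N)·(Σ_z ‖Ǩ_{bL}[Kf](z)‖(1+|z|) + Σ_z ‖Ǩ_L[Kc](z)‖(1+|z|)) ≤ ND 1` (position first moments, `O(|U| + c)` for the tower's top frames by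
`EngineV8.frameKernel_weightedL1_le`) and the degree cap `D₀` with `hDK`, `hDK″` is gone (`hRK : Kc.degree < R` stays).  Everything else — the fine covariance
frame swap `…TowerBaseGridFrameSwap.tower_base_grid_frameSwap_le`, the common sampled symbol `…TowerBaseGridSymbol.hubbardCovAboveCT_eq_normalCovariance_sampled`,
the splice `…TowerBaseGridSplice.tower_base_grid_keyedDefect_splice` — is unchanged.

* **`tower_base_grid_keyedDefect_le_mom`** — `Σ_{X p = w} ‖kernel (klGridAction (bL) M β U μ Kf) X − [keyed] kernel (klGridAction L M β U μ Kc)‖ ≤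
  (frame-swap terms) + (M4a‴ terms)`.

Proofs only; no definition.  Honest framing: a bound; nothing asserts HB1, any stub, K3, VL or superconductivity.
[cite: BenfattoGiulianiMastropietro2006, §2 (2.13)–(2.14), (2.77)–(2.80), §3 (3.3); Salmhofer1999, (2.102)–(2.106)]
-/

noncomputable section

namespace Summit.HubbardSuperconductivity.HubbardSuperconductivity.Theorems.TwoVolumeSource

set_option linter.dupNamespace false -- summit = problem name (single-conjunct summit), D-0017

open Finset Literature.MathematicalPhysics.QuantumLattice GrassmannAlgebra Literature.Probability.LatticeModels
  Literature.Probability.LatticeModels.BattleFederbush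
open Literature.MathematicalPhysics.QuantumLattice.FermiRG
open Summit.HubbardSuperconductivity.HubbardSuperconductivity.Theorems.KLProgrammeLegKernels
open Summit.HubbardSuperconductivity.HubbardSuperconductivity.Theorems.KLRegimeSplit
open Summit.HubbardSuperconductivity.HubbardSuperconductivity.Theorems.TwoPointAssembly
open Summit.HubbardSuperconductivity.HubbardSuperconductivity.Theorems.EngineV8
open Summit.HubbardSuperconductivity.HubbardSuperconductivity.Theorems.TwoVolumeDefect

set_option maxHeartbeats 800000 in -- two large instantiations (M3f-swap, M4a) and one splice
/-- **THE GRID-LEVEL TWO-VOLUME BASE DEFECT, CANONICALLY KEYED, AT ONE INSTANCE, first-moment counterterm budget** (see the module docstring).  `CL`, `CLf` are the coarse / fine grid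
covariances at the COMMON frame `Kc`, `CLff` the fine grid covariance at the fine frame `Kf` (all three given by their defining equations).
[folklore: composition of M3f (identity substitution), M4a‴ and the keyed splice; cite: BenfattoGiulianiMastropietro2006, §2–§3; Salmhofer1999, (2.102)–(2.106)] -/
theorem tower_base_grid_keyedDefect_le_mom {L b M : ℕ} [NeZero L] [NeZero (b * L)] [NeZero M] {β : ℝ} (hβ : 0 < β) (μ : ℝ) (Kc Kf : TrigPolyC4v)
    (CL : Matrix (GridLeg (GridPoint L (klGridN M))) (GridLeg (GridPoint L (klGridN M))) ℂ)
    (hCL : CL = (hubbardGridSub L M β (klGridN M)).transpose * hubbardCovAboveCT L M β μ 0 Kc (klScale klE0 1) * hubbardGridSub L M β (klGridN M))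
    (CLf : Matrix (GridLeg (GridPoint (b * L) (klGridN M))) (GridLeg (GridPoint (b * L) (klGridN M))) ℂ)
    (hCLf : CLf = (hubbardGridSub (b * L) M β (klGridN M)).transpose * hubbardCovAboveCT (b * L) M β μ 0 Kc (klScale klE0 1) * hubbardGridSub (b * L) M β (klGridN M))
    (CLff : Matrix (GridLeg (GridPoint (b * L) (klGridN M))) (GridLeg (GridPoint (b * L) (klGridN M))) ℂ)
    (hCLff : CLff = (hubbardGridSub (b * L) M β (klGridN M)).transpose * hubbardCovAboveCT (b * L) M β μ 0 Kf (klScale klE0 1) * hubbardGridSub (b * L) M β (klGridN M))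
    -- (A) the frame-swap data on the fine lattice (`…TowerBaseGridFrameSwap`)
    {κE : ℝ} (hκE : 0 < κE) (hGBE : ∀ t ∈ Set.Icc (0 : ℝ) 1, IsGramBoundedR (CLf + t • (CLff - CLf)) κE)
    {αC : ℝ} (hαC : 0 < αC) (hrowC : ∀ x, ∑ y, ‖CLf x y‖ ≤ αC) (hcolC : ∀ y, ∑ x, ‖CLf x y‖ ≤ αC)
    {sE cR cC : ℝ} (hcR : 0 ≤ cR) (hcC : 0 ≤ cC) (hsE : ∀ x y, ‖(CLff - CLf) x y‖ ≤ sE)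
    (hR : ∀ x, ∑ y, ‖(CLff - CLf) x y‖ ≤ cR) (hCc : ∀ y, ∑ x, ‖(CLff - CLf) x y‖ ≤ cC)
    (U : ℝ)
    (hXe : hubbardGridInteraction (b * L) (klGridN M) β U + hubbardGridCounterQuadratic (b * L) (klGridN M) β Kf ∈ evenOdd ℂ 0)
    (hX0 : constPart ℂ (hubbardGridInteraction (b * L) (klGridN M) β U + hubbardGridCounterQuadratic (b * L) (klGridN M) β Kf) = 0)
    (NX : ℕ → ℝ) (hNX0 : ∀ k, 0 ≤ NX k)
    (hNX : ∀ (k : ℕ) (p : Fin k) (y : GridLeg (GridPoint (b * L) (klGridN M))), ∑ Y ∈ univ.filter (fun Y : Fin k → GridLeg (GridPoint (b * L) (klGridN M)) => Y p = y),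
      ‖kernel ℂ (hubbardGridInteraction (b * L) (klGridN M) β U + hubbardGridCounterQuadratic (b * L) (klGridN M) β Kf) k Y‖ ≤ NX k)
    (NW : ℕ → ℝ) (hNW0 : ∀ m', 0 ≤ NW m')
    (hNW : ∀ m' (j : Fin (2 * m')) (x : GridLeg (GridPoint (b * L) (klGridN M))), ∑ Y ∈ univ.filter (fun Y : Fin (2 * m') → GridLeg (GridPoint (b * L) (klGridN M)) => Y j = x),
      ‖kernel ℂ (hubbardGridInteraction (b * L) (klGridN M) β U + hubbardGridCounterQuadratic (b * L) (klGridN M) β Kf) (2 * m') Y‖ ≤ NW m')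
    {ρS : ℝ} (hρS : 0 < ρS) (hθS₁ : Real.exp 1 * (αC + (cR + cC)) * normV (GridLeg (GridPoint (b * L) (klGridN M))) κE ρS NW / κE ^ 2 < 1)
    (hθS₂ : Real.exp 1 * αC * normV (GridLeg (GridPoint (b * L) (klGridN M))) κE ρS NW / κE ^ 2 < 1)
    -- (B) M4a's data (verbatim, `K := Kc`, `K″ := Kf`, `N := klGridN M`, `Lf := b * L`)
    (R R' : ℕ) (hRK : Kc.degree < R)
    (w : GridLeg (GridPoint (b * L) (klGridN M))) (hw : ∀ j, R + R' ≤ (w.1.1.2 j).val % L ∧ (w.1.1.2 j).val % L + (R + R') < L)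
    -- decay numbers of the two covariances
    {T : ℝ} (hT0 : 0 < T) (hT : ∀ X', ∑ Y' ∈ univ.filter (fun Y' : GridLeg (GridPoint (b * L) (klGridN M)) => R < Torus.tnorm (X'.1.1.2 - Y'.1.1.2)), ‖CLf X' Y'‖ ≤ T)
    {Te : ℝ} (hsec : ∀ (X' : GridLeg (GridPoint (b * L) (klGridN M))) (t : Fin (klGridN M)) (σ c : Fin 2),
      ∑ y ∈ univ.filter (fun y : TorusSite 2 (b * L) => R < Torus.tnorm (X'.1.1.2 - y)), ‖CLf X' (((t, y), σ), c)‖ ≤ Te)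
    {s s' : ℝ} (hs0 : 0 ≤ s) (hs'0 : 0 ≤ s') (hs : ∀ X Y, ‖CL X Y‖ ≤ s) (hs' : ∀ X' Y', ‖CLf X' Y'‖ ≤ s')
    {α α' : ℝ} (hαα : 0 < α' + α) (hrow : ∀ X, ∑ Y, ‖CL X Y‖ ≤ α) (hrow' : ∀ X', ∑ Y', ‖CLf X' Y'‖ ≤ α')
    {m₁ m₁' : ℝ} (hm0 : 0 ≤ m₁) (hm0' : 0 ≤ m₁')
    (hm1 : ∀ X, ∑ Y, ‖CL X Y‖ * (Torus.tnorm (X.1.1.2 - Y.1.1.2) : ℝ) ≤ m₁)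
    (hm1' : ∀ X', ∑ Y', ‖CLf X' Y'‖ *
      (Torus.tnorm ((fun i => (((X'.1.1.2 i).val : ℕ) : ZMod L)) - fun i => (((Y'.1.1.2 i).val : ℕ) : ZMod L)) : ℝ) ≤ m₁')
    -- replica-Gram-boundedness of the two covariances
    {κ κ' : ℝ} (hκ : 0 < κ) (hκ' : 0 < κ') (hGB : IsGramBoundedR CL κ) (hGB' : IsGramBoundedR CLf κ')
    -- the coarse partition function and OUTPUT weighted profile, and the two smallness conditions of the covariance bracket
    (hZ : IsUnit (effPartitionFn ℂ CL (hubbardGridInteraction L (klGridN M) β U + hubbardGridCounterQuadratic L (klGridN M) β Kc)))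
    (Nw : ℕ → ℝ) (hNw0 : ∀ m, 0 ≤ Nw m)
    (hNw : ∀ (m' : ℕ) (j : Fin (2 * m')) (x : GridLeg (GridPoint L (klGridN M))),
      ∑ Y ∈ univ.filter (fun Y : Fin (2 * m') → GridLeg (GridPoint L (klGridN M)) => Y j = x),
        ‖kernel ℂ (effAction ℂ CL (hubbardGridInteraction L (klGridN M) β U + hubbardGridCounterQuadratic L (klGridN M) β Kc)) (2 * m') Y‖ *
          (1 + labelDiam (fun Y₁ Y₂ : GridLeg (GridPoint L (klGridN M)) => (Torus.tnorm (Y₁.1.1.2 - Y₂.1.1.2) : ℝ)) (univ.image Y)) ≤ Nw m')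
    {ρf : ℝ} (hρf : 0 < ρf)
    (hθw : Real.exp 1 * (α' + α + (m₁' + m₁)) * normV (GridLeg (GridPoint (b * L) (klGridN M))) (κ' + κ) ρf Nw / (κ' + κ) ^ 2 < 1)
    {ρ₂ : ℝ} (hρ₂ : 0 < ρ₂)
    (hθ₂ : Real.exp 1 * (α' + α + (m₁' + m₁)) * normV (GridLeg (GridPoint (b * L) (klGridN M))) (κ' + κ + (κ' + κ + (κ' + κ))) ρ₂ Nw /
      (κ' + κ + (κ' + κ + (κ' + κ))) ^ 2 < 1)
    -- the INTERACTION bracket: weighted rows of the fine covariance in the block-periodic residue distance, majorant budgets of the three model profiles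
    {αw : ℝ} (hαw : 0 < αw)
    (hroww : ∀ X', ∑ Y', ‖CLf X' Y'‖ *
      (1 + (Torus.tnorm ((fun i => (((X'.1.1.2 i).val : ℕ) : ZMod L)) - fun i => (((Y'.1.1.2 i).val : ℕ) : ZMod L)) : ℝ)) ≤ αw)
    (hcolw : ∀ Y', ∑ X', ‖CLf X' Y'‖ *
      (1 + (Torus.tnorm ((fun i => (((X'.1.1.2 i).val : ℕ) : ZMod L)) - fun i => (((Y'.1.1.2 i).val : ℕ) : ZMod L)) : ℝ)) ≤ αw)
    (NV ND E : ℕ → ℝ) (hNV0 : ∀ m', 0 ≤ NV m') (hND0 : ∀ m', 0 ≤ ND m') (hE0 : ∀ m', 0 ≤ E m')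
    (hNV : ∀ m', (if m' = 1 then |β| / (klGridN M : ℕ) * ∑ z : TorusSite 2 L, ‖framePosKernel L Kc z‖ * (1 + torusSiteDist z 0)
      else if m' = 2 then |U| * |β| / (klGridN M : ℕ) else 0 : ℝ) ≤ NV m')
    (hND : |β| / (klGridN M : ℕ) * ∑ z : TorusSite 2 (b * L), ‖framePosKernel (b * L) Kf z‖ * (1 + torusSiteDist z 0) +
      |β| / (klGridN M : ℕ) * ∑ z : TorusSite 2 L, ‖framePosKernel L Kc z‖ * (1 + torusSiteDist z 0) ≤ ND 1)
    (hE : |β| / (klGridN M : ℕ) * (fsub Kf Kc).coeffNorm 0 ≤ E 1)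
    {ρ' : ℝ} (hρ' : 0 < ρ') {νEbar : ℝ} (hνE : normV (GridLeg (GridPoint (b * L) (klGridN M))) κ' ρ' E ≤ νEbar)
    (hbar : Real.exp 1 * αw * (normV (GridLeg (GridPoint (b * L) (klGridN M))) κ' ρ' (fun m' => NV m' + ND m') + νEbar) / κ' ^ 2 < 1)
    (hθ₂' : Real.exp 1 * αw * (normV (GridLeg (GridPoint (b * L) (klGridN M))) κ' ρ' NV + normV (GridLeg (GridPoint (b * L) (klGridN M))) κ' ρ' ND) / κ' ^ 2 < 1)
    (n : ℕ) (p : Fin (n + 1)) :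
    ∑ X ∈ univ.filter (fun X : Fin (n + 1) → GridLeg (GridPoint (b * L) (klGridN M)) => X p = w),
        ‖kernel ℂ (klGridAction (b * L) M β U μ Kf) (n + 1) X -
          (if ∀ i, (klGridBlockEquiv L b M (X i)).1 = (klGridBlockEquiv L b M (X p)).1 then
            kernel ℂ (klGridAction L M β U μ Kc) (n + 1) (fun i => (klGridBlockEquiv L b M (X i)).2) else 0)‖ ≤
      (((((n + 1 + 1) * (n + 1 + 2) : ℕ) : ℝ) / 2 * sE *
          (ρS⁻¹ ^ (n + 3) * (Real.exp 1 * normV (GridLeg (GridPoint (b * L) (klGridN M))) κE ρS NW) /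
            (1 - Real.exp 1 * (αC + (cR + cC)) * normV (GridLeg (GridPoint (b * L) (klGridN M))) κE ρS NW / κE ^ 2)) +
        ‖(2 : ℂ)⁻¹‖ * ∑ a' ∈ range (n + 2), ∑ b' ∈ range (n + 2),
          (if a' + b' = n + 1 then (((a' + 1) * (b' + 1) : ℕ) : ℝ) *
            (cR * (ρS⁻¹ ^ (a' + 1) * (Real.exp 1 * normV (GridLeg (GridPoint (b * L) (klGridN M))) κE ρS NW) /
                  (1 - Real.exp 1 * (αC + (cR + cC)) * normV (GridLeg (GridPoint (b * L) (klGridN M))) κE ρS NW / κE ^ 2)) *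
                (ρS⁻¹ ^ (b' + 1) * (Real.exp 1 * normV (GridLeg (GridPoint (b * L) (klGridN M))) κE ρS NW) /
                  (1 - Real.exp 1 * (αC + (cR + cC)) * normV (GridLeg (GridPoint (b * L) (klGridN M))) κE ρS NW / κE ^ 2)) +
              cC * (ρS⁻¹ ^ (a' + 1) * (Real.exp 1 * normV (GridLeg (GridPoint (b * L) (klGridN M))) κE ρS NW) /
                  (1 - Real.exp 1 * (αC + (cR + cC)) * normV (GridLeg (GridPoint (b * L) (klGridN M))) κE ρS NW / κE ^ 2)) *
                (ρS⁻¹ ^ (b' + 1) * (Real.exp 1 * normV (GridLeg (GridPoint (b * L) (klGridN M))) κE ρS NW) /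
                  (1 - Real.exp 1 * (αC + (cR + cC)) * normV (GridLeg (GridPoint (b * L) (klGridN M))) κE ρS NW / κE ^ 2))) else 0))) +
      ((ρ'⁻¹ ^ (n + 1) * Real.exp 1 / (1 - Real.exp 1 * αw * (normV (GridLeg (GridPoint (b * L) (klGridN M))) κ' ρ' (fun m' => NV m' + ND m') + νEbar) / κ' ^ 2) ^ 2) * normV (GridLeg (GridPoint (b * L) (klGridN M))) κ' ρ' E +
        (ρ'⁻¹ ^ (n + 1) * (Real.exp 1 * normV (GridLeg (GridPoint (b * L) (klGridN M))) κ' ρ' ND) / (1 - Real.exp 1 * αw * (normV (GridLeg (GridPoint (b * L) (klGridN M))) κ' ρ' NV + normV (GridLeg (GridPoint (b * L) (klGridN M))) κ' ρ' ND) / κ' ^ 2) ^ 2) * (1 + ((R' : ℝ) + 1))⁻¹ +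
        ((((n + 1 + 1) * (n + 1 + 2) : ℕ) : ℝ) / 2 *
            (ρ₂⁻¹ ^ (n + 3) * (Real.exp 1 * normV (GridLeg (GridPoint (b * L) (klGridN M))) (κ' + κ + (κ' + κ + (κ' + κ))) ρ₂ Nw) / (1 - Real.exp 1 * (α' + α + (m₁' + m₁)) * normV (GridLeg (GridPoint (b * L) (klGridN M))) (κ' + κ + (κ' + κ + (κ' + κ))) ρ₂ Nw / (κ' + κ + (κ' + κ + (κ' + κ))) ^ 2))) * Te +
        (‖(2 : ℂ)⁻¹‖ * ∑ a ∈ range (n + 2), ∑ b' ∈ range (n + 2),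
            (if a + b' = n + 1 then (((a + 1) * (b' + 1) : ℕ) : ℝ) *
              (4 * (ρ₂⁻¹ ^ (a + 1) * (Real.exp 1 * normV (GridLeg (GridPoint (b * L) (klGridN M))) (κ' + κ + (κ' + κ + (κ' + κ))) ρ₂ Nw) / (1 - Real.exp 1 * (α' + α + (m₁' + m₁)) * normV (GridLeg (GridPoint (b * L) (klGridN M))) (κ' + κ + (κ' + κ + (κ' + κ))) ρ₂ Nw / (κ' + κ + (κ' + κ + (κ' + κ))) ^ 2)) *
                (ρ₂⁻¹ ^ (b' + 1) * (Real.exp 1 * normV (GridLeg (GridPoint (b * L) (klGridN M))) (κ' + κ + (κ' + κ + (κ' + κ))) ρ₂ Nw) / (1 - Real.exp 1 * (α' + α + (m₁' + m₁)) * normV (GridLeg (GridPoint (b * L) (klGridN M))) (κ' + κ + (κ' + κ + (κ' + κ))) ρ₂ Nw / (κ' + κ + (κ' + κ + (κ' + κ))) ^ 2))) else 0)) * T +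
        ((((n + 1 + 1) * (n + 1 + 2) : ℕ) : ℝ) / 2 * (s' + s) *
              (ρf⁻¹ ^ (n + 3) * (Real.exp 1 * normV (GridLeg (GridPoint (b * L) (klGridN M))) (κ' + κ) ρf Nw) / (1 - Real.exp 1 * (α' + α + (m₁' + m₁)) * normV (GridLeg (GridPoint (b * L) (klGridN M))) (κ' + κ) ρf Nw / (κ' + κ) ^ 2)) +
            ‖(2 : ℂ)⁻¹‖ * ∑ a ∈ range (n + 2), ∑ b' ∈ range (n + 2),
              (if a + b' = n + 1 then (((a + 1) * (b' + 1) : ℕ) : ℝ) *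
                (2 * (α' + α) * (ρf⁻¹ ^ (a + 1) * (Real.exp 1 * normV (GridLeg (GridPoint (b * L) (klGridN M))) (κ' + κ) ρf Nw) / (1 - Real.exp 1 * (α' + α + (m₁' + m₁)) * normV (GridLeg (GridPoint (b * L) (klGridN M))) (κ' + κ) ρf Nw / (κ' + κ) ^ 2)) *
                  (ρf⁻¹ ^ (b' + 1) * (Real.exp 1 * normV (GridLeg (GridPoint (b * L) (klGridN M))) (κ' + κ) ρf Nw) / (1 - Real.exp 1 * (α' + α + (m₁' + m₁)) * normV (GridLeg (GridPoint (b * L) (klGridN M))) (κ' + κ) ρf Nw / (κ' + κ) ^ 2))) else 0)) * ((R' : ℝ) + 1)⁻¹) := by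
  classical
  subst hCL hCLf hCLff
  haveI : NeZero (klGridN M) := ⟨mul_ne_zero two_ne_zero (mul_ne_zero two_ne_zero (NeZero.ne M))⟩
  -- (A) the fine covariance frame swap
  have hr := tower_base_grid_frameSwap_le (V := b * L) (M := M) β U μ Kc Kf hκE hGBE hαC hrowC hcolC hcR hcC hsE hR hCc hXe hX0 NX hNX0 hNX
    NW hNW0 hNW hρS hθS₁ hθS₂ w n p
  -- (B) M4a at the common covariance frame, with the common volume-free sampled symbol
  obtain ⟨hCc_eq, hpc⟩ := hubbardCovAboveCT_eq_normalCovariance_sampled (V := L) (M := M) hβ μ Kc (klScale klE0 1)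
  obtain ⟨hCf_eq, hpf⟩ := hubbardCovAboveCT_eq_normalCovariance_sampled (V := b * L) (M := M) hβ μ Kc (klScale klE0 1)
  letI : LinearOrder (GridLeg (GridPoint (b * L) (klGridN M))) := LinearOrder.lift' (Fintype.equivFin (GridLeg (GridPoint (b * L) (klGridN M)))) (Fintype.equivFin _).injective
  have hD := hubbardGrid_sum_norm_kernel_twoVolume_stepZero_le_mom (b := b) (L := L) (Lf := b * L) (M := M) (N := klGridN M) rfl hβ.ne'
    (fun (i : MatsubaraIdx M) (_ : Fin 2) (q : Fin 2 → ℝ) => uvSymbolFn 1 (klScale klE0 1) (-2 * ∑ l, Real.cos (q l) - μ - Kc.eval q) (matsubaraFreq β M i)) _ _ hpc hpf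
    ((hubbardGridSub L M β (klGridN M)).transpose * hubbardCovAboveCT L M β μ 0 Kc (klScale klE0 1) * hubbardGridSub L M β (klGridN M)) (by rw [hCc_eq])
    ((hubbardGridSub (b * L) M β (klGridN M)).transpose * hubbardCovAboveCT (b * L) M β μ 0 Kc (klScale klE0 1) * hubbardGridSub (b * L) M β (klGridN M))
    (by rw [hCf_eq]) U Kc Kf R R' hRK w hw hT0 hT hsec hs0 hs'0 hs hs' hαα hrow hrow' hm0 hm0' hm1 hm1' hκ hκ' hGB hGB' hZ Nw hNw0 hNw
    hρf hθw hρ₂ hθ₂ hαw hroww hcolw NV ND E hNV0 hND0 hE0 hNV hND hE hρ' hνE hbar hθ₂' n p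
  -- (C) splice
  refine tower_base_grid_keyedDefect_splice _ _ (klGridAction L M β U μ Kc) p w hr ?_
  unfold klGridAction
  convert hD using 3

end Summit.HubbardSuperconductivity.HubbardSuperconductivity.Theorems.TwoVolumeSource

end
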